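import Summits.Ventures.Crystal3D.Theorems.StickyWulffConstantPolycrystalWulffBoundPerSelf
import Summits.Ventures.Crystal3D.Theorems.StickyWulffConstantTextureLiminfTexShadowDefs
import Literature.Analysis.Convexity.OpenHPolytope

/-!
# `PolycrystalWulffBound`: the cubic Wulff body as an EXPLICIT `H`-polytope — the fourteen unit-normal
# constraints, their support values, closure, boundedness and distinct facet planes
# (crux `stmt-Ventures-19482` / `23911`; first brick of the kernel E₀-equality, memo P-TWIN-g16 §2)

Route `StickyWulffConstant` of the venture `Summits/Ventures/Crystal3D`, second prover lane (poly-p2,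
gen 16).  The truncated octahedron `W_cubic = fccWulffBody = {‖y‖_∞ ≤ 2} ∩ {‖y‖₁ ≤ 3}`
(`mem_fccWulffBody_iff`) is the closed `H`-polytope of the fourteen constraints

  `wulffHRep = {(±e_i, 2) : i} ∪ {((±1,±1,±1)/√3, √3)}`

with UNIT outer normals (`wulffHRep_norm_eq_one`), positive levels, support values
`h_W(p.1) = p.2` attained on every facet (`supportFn_fccWulffBody_eq`), `0` in the open polytope,
`closure (polytope wulffHRep) = fccWulffBody`, bounded open polytope, and PAIRWISE DISTINCT facet
planes (`wulffHRep_planes_ne`, from the general `eq_of_plane_eq`: two planes `{⟪n,x⟫ = b}`,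
`{⟪n',x⟫ = b'}` with unit normals and positive levels coincide only if `(n,b) = (n',b')`).
These are exactly the hypotheses of clause (A) of `PolytopeCalculus` (`stub_polytopeCalculus`), so
the facet formula applies to `W_cubic` and to its half-space cuts — the input of the coherent-twin
equality computation `F(E₀) = 96` (next brick).
WHAT THIS IS NOT: any facet AREA; anything about textures; the crux is not claimed.
-/

noncomputable section

open scoped BigOperators InnerProductSpace ENNReal
open MeasureTheory Set

namespace Summit.Ventures.Crystal3D.Theorems

open Summit.Ventures.Crystal3D.Cruxes.TextureLiminf.TexShadow (E3 polytope supportFn)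

open Literature.MathematicalPhysics.StatisticalMechanics (fccWulffBody mem_fccWulffBody_iff
  isCompact_fccWulffBody)

/-! ### The fourteen constraints -/

/-- The square-facet normals `±e_i`. -/
def wulffSqNormal (ib : Fin 3 × Bool) : E3 :=
  EuclideanSpace.single ib.1 (if ib.2 then (1 : ℝ) else -1)

/-- The hexagonal-facet normals `(±1,±1,±1)/√3`. -/
def wulffHexNormal (σ : Fin 3 → Bool) : E3 :=
  WithLp.toLp 2 fun i => if σ i then (Real.sqrt 3)⁻¹ else -(Real.sqrt 3)⁻¹

/-- The `H`-representation of the cubic Wulff body: six square constraints at level `2`, eight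
hexagonal constraints at level `√3`. -/
def wulffHRep : Finset (E3 × ℝ) :=
  (Finset.univ.image fun ib : Fin 3 × Bool => (wulffSqNormal ib, (2 : ℝ))) ∪
  (Finset.univ.image fun σ : Fin 3 → Bool => (wulffHexNormal σ, Real.sqrt 3))

/-- Membership in `wulffHRep`: a square constraint `(±e_i, 2)` or a hexagonal one `((±1,±1,±1)/√3, √3)`. -/
theorem mem_wulffHRep_iff (p : E3 × ℝ) :
    p ∈ wulffHRep ↔ (∃ ib : Fin 3 × Bool, p = (wulffSqNormal ib, (2 : ℝ))) ∨
      ∃ σ : Fin 3 → Bool, p = (wulffHexNormal σ, Real.sqrt 3) := by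
  simp only [wulffHRep, Finset.mem_union, Finset.mem_image, Finset.mem_univ, true_and]
  constructor
  · rintro (⟨ib, h⟩ | ⟨σ, h⟩)
    · exact Or.inl ⟨ib, h.symm⟩
    · exact Or.inr ⟨σ, h.symm⟩
  · rintro (⟨ib, h⟩ | ⟨σ, h⟩)
    · exact Or.inl ⟨ib, h.symm⟩
    · exact Or.inr ⟨σ, h.symm⟩

/-- `⟪x, ±e_i⟫ = ±x_i`. -/
theorem inner_wulffSqNormal (x : E3) (ib : Fin 3 × Bool) :
    ⟪x, wulffSqNormal ib⟫_ℝ = if ib.2 then x ib.1 else -x ib.1 := by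
  rw [wulffSqNormal, EuclideanSpace.inner_single_right]
  split_ifs <;> simp

/-- `⟪x, (±1,±1,±1)/√3⟫ = (√3)⁻¹ Σ ±x_i`. -/
theorem inner_wulffHexNormal (x : E3) (σ : Fin 3 → Bool) :
    ⟪x, wulffHexNormal σ⟫_ℝ = (Real.sqrt 3)⁻¹ * ∑ i, (if σ i then x i else -x i) := by
  have e1 : ⟪x, wulffHexNormal σ⟫_ℝ = ∑ i, x i * wulffHexNormal σ i := by
    simp [EuclideanSpace.inner_eq_star_dotProduct, dotProduct, mul_comm]
  rw [e1, Finset.mul_sum]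
  refine Finset.sum_congr rfl fun i _ => ?_
  show x i * (if σ i then (Real.sqrt 3)⁻¹ else -(Real.sqrt 3)⁻¹) = _
  split_ifs <;> ring

/-- The square normals are unit vectors. -/
theorem norm_wulffSqNormal (ib : Fin 3 × Bool) : ‖wulffSqNormal ib‖ = 1 := by
  rcases ib with ⟨i, b⟩
  cases b <;> simp [wulffSqNormal]

/-- The hexagonal normals are unit vectors. -/
theorem norm_wulffHexNormal (σ : Fin 3 → Bool) : ‖wulffHexNormal σ‖ = 1 := by
  have h3sq : Real.sqrt 3 ^ 2 = 3 := Real.sq_sqrt (by norm_num)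
  have husq : ∀ i, ‖wulffHexNormal σ i‖ ^ 2 = 1 / 3 := by
    intro i
    have : wulffHexNormal σ i = if σ i then (Real.sqrt 3)⁻¹ else -(Real.sqrt 3)⁻¹ := rfl
    rw [this, Real.norm_eq_abs, sq_abs]
    split_ifs
    · rw [inv_pow, h3sq]; norm_num
    · rw [neg_sq, inv_pow, h3sq]; norm_num
  rw [EuclideanSpace.norm_eq, Fin.sum_univ_three, husq, husq, husq]
  norm_num

/-- Every constraint of `wulffHRep` has a unit normal. -/
theorem wulffHRep_norm_eq_one : ∀ p ∈ wulffHRep, ‖p.1‖ = 1 := by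
  intro p hp
  rcases (mem_wulffHRep_iff p).1 hp with ⟨ib, rfl⟩ | ⟨σ, rfl⟩
  · exact norm_wulffSqNormal ib
  · exact norm_wulffHexNormal σ

/-- Every constraint of `wulffHRep` has a positive level. -/
theorem wulffHRep_snd_pos : ∀ p ∈ wulffHRep, 0 < p.2 := by
  intro p hp
  rcases (mem_wulffHRep_iff p).1 hp with ⟨ib, rfl⟩ | ⟨σ, rfl⟩
  · norm_num
  · exact Real.sqrt_pos.2 (by norm_num)

/-! ### The cubic Wulff body is the closed `H`-polytope of `wulffHRep` -/

/-- `W_cubic = {x | ∀ p ∈ wulffHRep, ⟪p.1, x⟫ ≤ p.2}`. -/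
theorem fccWulffBody_eq_closedHPolytope :
    fccWulffBody = {x : E3 | ∀ p ∈ wulffHRep, ⟪p.1, x⟫_ℝ ≤ p.2} := by
  have h3pos : 0 < Real.sqrt 3 := Real.sqrt_pos.2 (by norm_num)
  have h3sq : Real.sqrt 3 ^ 2 = 3 := Real.sq_sqrt (by norm_num)
  have h3inv : (Real.sqrt 3)⁻¹ * 3 = Real.sqrt 3 := by
    rw [inv_mul_eq_iff_eq_mul₀ h3pos.ne', ← sq, h3sq]
  ext x
  rw [mem_fccWulffBody_iff, mem_setOf_eq]
  constructor
  · rintro ⟨hcoord, hsum⟩ p hp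
    rw [real_inner_comm]
    rcases (mem_wulffHRep_iff p).1 hp with ⟨⟨i, b⟩, rfl⟩ | ⟨σ, rfl⟩
    · show ⟪x, wulffSqNormal (i, b)⟫_ℝ ≤ 2
      rw [inner_wulffSqNormal]
      have := hcoord i
      rw [abs_le] at this
      split_ifs <;> linarith [this.1, this.2]
    · show ⟪x, wulffHexNormal σ⟫_ℝ ≤ Real.sqrt 3
      rw [inner_wulffHexNormal]
      have hle : ∑ i, (if σ i then x i else -x i) ≤ ∑ i, |x i| :=
        Finset.sum_le_sum fun i _ => by split_ifs <;> [exact le_abs_self _; exact neg_le_abs _]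
      calc (Real.sqrt 3)⁻¹ * ∑ i, (if σ i then x i else -x i)
          ≤ (Real.sqrt 3)⁻¹ * 3 := mul_le_mul_of_nonneg_left (hle.trans hsum) (inv_pos.2 h3pos).le
        _ = Real.sqrt 3 := h3inv
  · intro h
    refine ⟨fun i => ?_, ?_⟩
    · rw [abs_le]
      constructor
      · have h1 := h (wulffSqNormal (i, false), 2) ((mem_wulffHRep_iff _).2 (Or.inl ⟨(i, false), rfl⟩))
        rw [real_inner_comm, inner_wulffSqNormal] at h1
        simp only [Bool.false_eq_true, ↓reduceIte] at h1
        linarith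
      · have h1 := h (wulffSqNormal (i, true), 2) ((mem_wulffHRep_iff _).2 (Or.inl ⟨(i, true), rfl⟩))
        rw [real_inner_comm, inner_wulffSqNormal] at h1
        simpa using h1
    · set σ : Fin 3 → Bool := fun i => decide (0 ≤ x i) with hσ
      have h1 := h (wulffHexNormal σ, Real.sqrt 3) ((mem_wulffHRep_iff _).2 (Or.inr ⟨σ, rfl⟩))
      rw [real_inner_comm, inner_wulffHexNormal] at h1
      have hs : ∑ i, (if σ i then x i else -x i) = ∑ i, |x i| := by
        refine Finset.sum_congr rfl fun i _ => ?_
        by_cases hi : 0 ≤ x i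
        · have : σ i = true := by rw [hσ]; exact decide_eq_true hi
          rw [if_pos this, abs_of_nonneg hi]
        · have : σ i = false := by rw [hσ]; exact decide_eq_false hi
          rw [this, abs_of_neg (lt_of_not_ge hi)]; simp
      rw [hs] at h1
      -- `(√3)⁻¹ · S ≤ √3` ⇒ `S ≤ 3`
      have h2 : (Real.sqrt 3)⁻¹ * ∑ i, |x i| ≤ (Real.sqrt 3)⁻¹ * 3 := by rw [h3inv]; exact h1
      exact le_of_mul_le_mul_left h2 (inv_pos.2 h3pos)

/-- `0` lies in the open polytope of `wulffHRep`. -/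
theorem zero_mem_polytope_wulffHRep : (0 : E3) ∈ polytope wulffHRep := by
  simp only [polytope, mem_iInter, mem_setOf_eq, inner_zero_right]
  exact fun p hp => wulffHRep_snd_pos p hp

/-- The open polytope of `wulffHRep` lies in the cubic Wulff body. -/
theorem polytope_wulffHRep_subset : polytope wulffHRep ⊆ fccWulffBody := by
  rw [fccWulffBody_eq_closedHPolytope]
  intro x hx
  simp only [polytope, mem_iInter, mem_setOf_eq] at hx
  exact fun p hp => (hx p hp).le

/-- The open polytope of `wulffHRep` is bounded. -/
theorem isBounded_polytope_wulffHRep : Bornology.IsBounded (polytope wulffHRep) :=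
  isCompact_fccWulffBody.isBounded.subset polytope_wulffHRep_subset

/-- `closure (polytope wulffHRep) = W_cubic`. -/
theorem closure_polytope_wulffHRep : closure (polytope wulffHRep) = fccWulffBody := by
  rw [fccWulffBody_eq_closedHPolytope]
  have h := Literature.Analysis.Convexity.closure_openHPolytope_eq wulffHRep
    ⟨0, zero_mem_polytope_wulffHRep⟩
  simpa only [polytope, Set.ext_iff, mem_iInter, mem_setOf_eq] using h

/-! ### Support values: `h_W(p.1) = p.2` on every constraint -/

/-- The support value of the cubic Wulff body in the direction of each constraint normal is the
constraint level (attained: at `±2e_i` on the squares, at `(±1,±1,±1)` on the hexagons). -/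
theorem supportFn_fccWulffBody_eq : ∀ p ∈ wulffHRep, supportFn fccWulffBody p.1 = p.2 := by
  have h3pos : 0 < Real.sqrt 3 := Real.sqrt_pos.2 (by norm_num)
  have h3sq : Real.sqrt 3 ^ 2 = 3 := Real.sq_sqrt (by norm_num)
  intro p hp
  -- upper bound from the `H`-representation
  have hub : ∀ y ∈ fccWulffBody, ⟪y, p.1⟫_ℝ ≤ p.2 := by
    intro y hy
    rw [fccWulffBody_eq_closedHPolytope] at hy
    rw [real_inner_comm]
    exact hy p hp
  -- attained
  have hatt : ∃ y ∈ fccWulffBody, ⟪y, p.1⟫_ℝ = p.2 := by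
    rcases (mem_wulffHRep_iff p).1 hp with ⟨⟨i, b⟩, rfl⟩ | ⟨σ, rfl⟩
    · refine ⟨EuclideanSpace.single i (if b then (2 : ℝ) else -2), ?_, ?_⟩
      · rw [mem_fccWulffBody_iff]
        constructor
        · intro j
          fin_cases i <;> fin_cases j <;> cases b <;> simp
        · fin_cases i <;> cases b <;> simp [Fin.sum_univ_three] <;> norm_num
      · show ⟪(EuclideanSpace.single i (if b then (2 : ℝ) else -2) : E3), wulffSqNormal (i, b)⟫_ℝ = 2
        rw [inner_wulffSqNormal]
        cases b <;> simp
    · refine ⟨WithLp.toLp 2 fun j => if σ j then (1 : ℝ) else -1, ?_, ?_⟩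
      · rw [mem_fccWulffBody_iff]
        have happ : ∀ j, (WithLp.toLp 2 fun j => if σ j then (1 : ℝ) else -1 : E3) j =
            if σ j then (1 : ℝ) else -1 := fun j => rfl
        constructor
        · intro j; rw [happ]; split_ifs <;> norm_num
        · have : ∀ j, |(WithLp.toLp 2 fun j => if σ j then (1 : ℝ) else -1 : E3) j| = 1 := by
            intro j; rw [happ]; split_ifs <;> norm_num
          simp_rw [this]
          norm_num
      · show ⟪(WithLp.toLp 2 fun j => if σ j then (1 : ℝ) else -1 : E3), wulffHexNormal σ⟫_ℝ =
          Real.sqrt 3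
        rw [inner_wulffHexNormal]
        have happ : ∀ j, (WithLp.toLp 2 fun j => if σ j then (1 : ℝ) else -1 : E3) j =
            if σ j then (1 : ℝ) else -1 := fun j => rfl
        have : ∑ j, (if σ j then (WithLp.toLp 2 fun j => if σ j then (1 : ℝ) else -1 : E3) j
            else -(WithLp.toLp 2 fun j => if σ j then (1 : ℝ) else -1 : E3) j) = 3 := by
          have h1 : ∀ j, (if σ j then (WithLp.toLp 2 fun j => if σ j then (1 : ℝ) else -1 : E3) j
              else -(WithLp.toLp 2 fun j => if σ j then (1 : ℝ) else -1 : E3) j) = 1 := by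
            intro j; rw [happ]; split_ifs <;> norm_num
          simp_rw [h1]; norm_num
        rw [this, inv_mul_eq_iff_eq_mul₀ h3pos.ne', ← sq, h3sq]
  obtain ⟨y₀, hy₀, hy₀v⟩ := hatt
  unfold supportFn
  refine IsGreatest.csSup_eq ⟨⟨y₀, hy₀, hy₀v⟩, ?_⟩
  rintro _ ⟨y, hy, rfl⟩
  exact hub y hy

/-! ### Distinct facet planes -/

/-- Two planes `{⟪n, x⟫ = b}` and `{⟪n', x⟫ = b'}` with unit normals and positive levels coincide
only if `n = n'` and `b = b'`. -/
theorem eq_of_plane_eq {n n' : E3} {b b' : ℝ} (hn : ‖n‖ = 1) (hn' : ‖n'‖ = 1) (hb : 0 < b)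
    (hb' : 0 < b') (h : {x : E3 | ⟪n, x⟫_ℝ = b} = {x : E3 | ⟪n', x⟫_ℝ = b'}) :
    n = n' ∧ b = b' := by
  have hnn : ⟪n, n⟫_ℝ = 1 := by rw [real_inner_self_eq_norm_sq, hn, one_pow]
  have hn'n' : ⟪n', n'⟫_ℝ = 1 := by rw [real_inner_self_eq_norm_sq, hn', one_pow]
  -- points of the first plane
  have hmem : ∀ x : E3, ⟪n, x⟫_ℝ = b → ⟪n', x⟫_ℝ = b' := by
    intro x hx
    have : x ∈ {x : E3 | ⟪n', x⟫_ℝ = b'} := by rw [← h]; exact hx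
    exact this
  have h1 : ⟪n', b • n⟫_ℝ = b' := hmem _ (by rw [inner_smul_right, hnn, mul_one])
  rw [inner_smul_right] at h1
  -- `v = n' − ⟪n,n'⟫ n` is orthogonal to `n`
  set c : ℝ := ⟪n, n'⟫_ℝ with hc
  have h2 : ⟪n', b • n + (n' - c • n)⟫_ℝ = b' := hmem _ (by
    rw [inner_add_right, inner_smul_right, hnn, mul_one, inner_sub_right, inner_smul_right, hnn,
      hc, mul_one, sub_self, add_zero])
  rw [inner_add_right, inner_smul_right, inner_sub_right, inner_smul_right, hn'n',
    real_inner_comm n n'] at h2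
  -- so `1 − c² = 0`
  have hc2 : c ^ 2 = 1 := by
    have : b * c + (1 - c * c) = b * c := by
      rw [real_inner_comm n n'] at h1
      linarith
    nlinarith [this]
  have hcpos : 0 < c := by
    rw [real_inner_comm n n'] at h1
    by_contra hle
    have : b * c ≤ 0 := mul_nonpos_of_nonneg_of_nonpos hb.le (not_lt.1 hle)
    linarith
  have hc1 : c = 1 := by nlinarith [hc2, hcpos]
  have hnn' : n = n' := by
    have hdist : ‖n - n'‖ ^ 2 = 0 := by
      rw [@norm_sub_sq_real, hn, hn', ← hc, hc1]; norm_num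
    have := pow_eq_zero_iff (n := 2) (by norm_num) |>.1 hdist
    exact sub_eq_zero.1 (norm_eq_zero.1 this)
  refine ⟨hnn', ?_⟩
  rw [real_inner_comm n n', ← hc, hc1, mul_one] at h1
  exact h1

/-- The facet planes of `wulffHRep` are pairwise distinct. -/
theorem wulffHRep_planes_ne : ∀ p ∈ wulffHRep, ∀ p' ∈ wulffHRep, p ≠ p' →
    {x : E3 | ⟪p.1, x⟫_ℝ = p.2} ≠ {x : E3 | ⟪p'.1, x⟫_ℝ = p'.2} := by
  intro p hp p' hp' hne heq
  obtain ⟨h1, h2⟩ := eq_of_plane_eq (wulffHRep_norm_eq_one p hp) (wulffHRep_norm_eq_one p' hp')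
    (wulffHRep_snd_pos p hp) (wulffHRep_snd_pos p' hp') heq
  exact hne (Prod.ext h1 h2)

end Summit.Ventures.Crystal3D.Theorems

end
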